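import Mathlib
import Literature.MathematicalPhysics.KineticTheory.LinearisedPhononCollisionOperator
import HarnessLib

/-!
# Global factorisation of the resonance function — `stub_resonanceFactorisation` (stub I1) of line `swap-odd-threshold-rigidity`
(crux `EmbeddedDrudeMourre.MourreDissolution`, item stmt-AtomisticToContinuum-12594; helper file, `--supports`)

Registered stub I1 of the checked skeleton of line `swap-odd-threshold-rigidity` (lead c8), in the
skeleton's stub namespace `Summit.AtomisticToContinuum.FouriersLaw.Theorems.MourreDissolution`.

For the pinned band `ω(k) = √(ω₂ + 2(1 − cos k))` (`PhononBoltzmann.dispersion`, `ω₂ ≥ 0`) and the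
resonance function `Ω(k₁,k₂,k₃) = ω₁ + ω₂ − ω₃ − ω₄` (`resonanceFn`; `ωⱼ = ω(kⱼ)`, `k₄ = k₁ + k₂ − k₃`):

  `Ω · (ω₁+ω₂+ω₃+ω₄) · (ω₁ω₂+ω₃ω₄) = 8 sin((k₃−k₁)/2) sin((k₂−k₃)/2) · H`,
  `H = (ω₁ω₂ + ω₃ω₄ + 2(ω₂+2)) cos((k₁+k₂)/2) − 4 cos((k₃−k₁)/2) cos((k₂−k₃)/2)`.

Proof: `Ω·(Σω) = (ω₁+ω₂)² − (ω₃+ω₄)² = Δ + 2(ω₁ω₂ − ω₃ω₄)`, `Δ = ω₁²+ω₂²−ω₃²−ω₄²`, and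
`(ω₁ω₂ − ω₃ω₄)(ω₁ω₂ + ω₃ω₄) = ω₁²ω₂² − ω₃²ω₄²`; with `ωⱼ² = (ω₂+2) − 2 cos kⱼ` (`dispersion_sq`)
everything reduces to the two four-term trigonometric identities, written in the half-angle
variables `p = (k₃−k₁)/2`, `q = (k₂−k₃)/2`, `r = (k₁+k₂)/2` (so that `k₁ = r−p−q`, `k₂ = r+p+q`,
`k₃ = r+p−q`, `k₄ = r−p+q`):
* `cos k₁ + cos k₂ − cos k₃ − cos k₄ = −4 sin p sin q cos r`,
* `cos k₁ cos k₂ − cos k₃ cos k₄ = −4 sin p sin q cos p cos q`.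
Pure algebra/trigonometry; no cited facts.
-/

noncomputable section

namespace Summit.AtomisticToContinuum.FouriersLaw.Theorems.MourreDissolution

open Literature.MathematicalPhysics.KineticTheory
open Literature.MathematicalPhysics.KineticTheory.PhononBoltzmann

/-! ### The two four-term trigonometric identities -/

/-- `cos(r−p−q) + cos(r+p+q) − cos(r+p−q) − cos(r−p+q) = −4 sin p sin q cos r`
(sum-to-product twice). [folklore] -/
theorem resonanceFactorisation_cos_four (p q r : ℝ) :
    Real.cos (r - p - q) + Real.cos (r + p + q) - Real.cos (r + p - q) - Real.cos (r - p + q) =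
      -4 * Real.sin p * Real.sin q * Real.cos r := by
  simp only [Real.cos_add, Real.cos_sub, Real.sin_add, Real.sin_sub]
  ring

/-- `cos(r−p−q) cos(r+p+q) − cos(r+p−q) cos(r−p+q) = −4 sin p sin q cos p cos q`
(`cos(x−y)cos(x+y) = cos²x − sin²y` twice). [folklore] -/
theorem resonanceFactorisation_cos_mul_cos_four (p q r : ℝ) :
    Real.cos (r - p - q) * Real.cos (r + p + q) - Real.cos (r + p - q) * Real.cos (r - p + q) =
      -4 * Real.sin p * Real.sin q * Real.cos p * Real.cos q := by
  simp only [Real.cos_add, Real.cos_sub, Real.sin_add, Real.sin_sub]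
  linear_combination (-4 * Real.sin p * Real.sin q * Real.cos p * Real.cos q) *
    Real.sin_sq_add_cos_sq r

/-! ### The algebraic core -/

/-- Algebraic core of the factorisation: if `wⱼ² = A − 2Cⱼ` (`j = 1..4`),
`C₁ + C₂ − C₃ − C₄ = −4 σp σq cr` and `C₁C₂ − C₃C₄ = −4 σp σq cp cq`, then
`(w₁+w₂−w₃−w₄)(w₁+w₂+w₃+w₄)(w₁w₂+w₃w₄) = 8 σp σq ((w₁w₂+w₃w₄+2A) cr − 4 cp cq)`. [folklore] -/
theorem resonanceFactorisation_alg {A w₁ w₂ w₃ w₄ C₁ C₂ C₃ C₄ σp σq cp cq cr : ℝ}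
    (hw₁ : w₁ ^ 2 = A - 2 * C₁) (hw₂ : w₂ ^ 2 = A - 2 * C₂) (hw₃ : w₃ ^ 2 = A - 2 * C₃)
    (hw₄ : w₄ ^ 2 = A - 2 * C₄) (hT₁ : C₁ + C₂ - C₃ - C₄ = -4 * σp * σq * cr)
    (hT₂ : C₁ * C₂ - C₃ * C₄ = -4 * σp * σq * cp * cq) :
    (w₁ + w₂ - w₃ - w₄) * ((w₁ + w₂ + w₃ + w₄) * (w₁ * w₂ + w₃ * w₄)) =
      8 * σp * σq * ((w₁ * w₂ + w₃ * w₄ + 2 * A) * cr - 4 * cp * cq) := by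
  linear_combination (w₁ * w₂ + w₃ * w₄ + 2 * (A - 2 * C₂)) * hw₁ +
    (w₁ * w₂ + w₃ * w₄ + 2 * w₁ ^ 2) * hw₂ - (w₁ * w₂ + w₃ * w₄ + 2 * (A - 2 * C₄)) * hw₃ -
    (w₁ * w₂ + w₃ * w₄ + 2 * w₃ ^ 2) * hw₄ - (2 * (w₁ * w₂ + w₃ * w₄) + 4 * A) * hT₁ + 8 * hT₂

/-! ### The factorisation -/

/-- **Global factorisation of the resonance function** (stub I1 of line
`swap-odd-threshold-rigidity`). For `ω₂ ≥ 0` and all real `k₁, k₂, k₃` (`k₄ = k₁+k₂−k₃`,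
`ωⱼ = ω(kⱼ)`): `Ω·(ω₁+ω₂+ω₃+ω₄)·(ω₁ω₂+ω₃ω₄) = 8 sin((k₃−k₁)/2) sin((k₂−k₃)/2)·H` with
`H = (ω₁ω₂+ω₃ω₄+2(ω₂+2)) cos((k₁+k₂)/2) − 4 cos((k₃−k₁)/2) cos((k₂−k₃)/2)`. In particular the
non-perturbative branch of the resonant set `{Ω = 0}` is the sheet `{H = 0}`, the two exchange planes
being `{sin((k₃−k₁)/2) = 0}` and `{sin((k₂−k₃)/2) = 0}`. [folklore] -/
theorem stub_resonanceFactorisation :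
    ∀ ω₂ : ℝ, 0 ≤ ω₂ → ∀ k₁ k₂ k₃ : ℝ,
      resonanceFn ω₂ k₁ k₂ k₃ *
          ((dispersion ω₂ k₁ + dispersion ω₂ k₂ + dispersion ω₂ k₃ + dispersion ω₂ (k₁ + k₂ - k₃)) *
            (dispersion ω₂ k₁ * dispersion ω₂ k₂ + dispersion ω₂ k₃ * dispersion ω₂ (k₁ + k₂ - k₃))) =
        8 * Real.sin ((k₃ - k₁) / 2) * Real.sin ((k₂ - k₃) / 2) *
          ((dispersion ω₂ k₁ * dispersion ω₂ k₂ + dispersion ω₂ k₃ * dispersion ω₂ (k₁ + k₂ - k₃) +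
                2 * (ω₂ + 2)) * Real.cos ((k₁ + k₂) / 2) -
            4 * Real.cos ((k₃ - k₁) / 2) * Real.cos ((k₂ - k₃) / 2)) := by
  intro ω₂ hω k₁ k₂ k₃
  have hT₁ := resonanceFactorisation_cos_four ((k₃ - k₁) / 2) ((k₂ - k₃) / 2) ((k₁ + k₂) / 2)
  have hT₂ := resonanceFactorisation_cos_mul_cos_four ((k₃ - k₁) / 2) ((k₂ - k₃) / 2) ((k₁ + k₂) / 2)
  have e₁ : (k₁ + k₂) / 2 - (k₃ - k₁) / 2 - (k₂ - k₃) / 2 = k₁ := by ring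
  have e₂ : (k₁ + k₂) / 2 + (k₃ - k₁) / 2 + (k₂ - k₃) / 2 = k₂ := by ring
  have e₃ : (k₁ + k₂) / 2 + (k₃ - k₁) / 2 - (k₂ - k₃) / 2 = k₃ := by ring
  have e₄ : (k₁ + k₂) / 2 - (k₃ - k₁) / 2 + (k₂ - k₃) / 2 = k₁ + k₂ - k₃ := by ring
  rw [e₁, e₂, e₃, e₄] at hT₁ hT₂
  have hw : ∀ k : ℝ, dispersion ω₂ k ^ 2 = (ω₂ + 2) - 2 * Real.cos k := fun k => by
    rw [dispersion_sq hω]; ring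
  unfold resonanceFn
  exact resonanceFactorisation_alg (hw k₁) (hw k₂) (hw k₃) (hw (k₁ + k₂ - k₃)) hT₁ hT₂

end Summit.AtomisticToContinuum.FouriersLaw.Theorems.MourreDissolution
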